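import Literature.MathematicalPhysics.QuantumLattice.HubbardTTPrimeMeanEnergySupergradient
import Literature.MathematicalPhysics.QuantumLattice.HubbardNNNHoppingEnergyDensityRegionBounds
import Literature.MathematicalPhysics.QuantumLattice.HubbardFillingBoxEnergyBounds
import Literature.MathematicalPhysics.QuantumLattice.BoxDualCovarianceCombination
import Literature.MathematicalPhysics.QuantumLattice.HubbardTTPrimeDiagHopTransport
import Literature.Computation.Certificates.BoxCoveringByCells
import HarnessLib

/-!
# Box words for the `t–t'` Hubbard family: a delivered parameter box inside a grid of certified
# cells carries the weakest cell word (energy windows, ground-state observable floors), and the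
# interval extension of the one-anchor tangent cap over a rectangle

Family `hubbard` (topic `MathematicalPhysics/QuantumLattice`); written for stage S2 of the Hubbard
material oracle (D-0096/D-0097 "points → boxes"; first object the cuprate box
`(U, t', n) = (8 ± 0.5, −0.25 ± 0.05, 0.875 ± 0.01)`). A router (stage S1) delivers an axis-aligned
BOX of couplings; the certifier issues words CELL BY CELL on its own grid (energy windows from the
region toolkit `HubbardNNNHoppingEnergyDensityRegionBounds`, correlator floors from the window
certificates `HubbardTTPrimeWindowCertificateConvexComb` / `BoxDualCovarianceCombination`, cell
rules `SharedVaryingBoxCertificate`). This file is the t–t' instance of the generic covering rule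
`Literature/Computation/Certificates/BoxCoveringByCells`: no new certificate is solved, no transport
inside a cell is performed — the box word is the weakest cell word over the cells the box meets, and
the only interface check is that the box sits inside the gridded extent (two inequalities per
coordinate; breakpoints need not be monotone).

* §1 `energyDensityTT'_le_of_forall_isTorusLimitOf_slopes_on_rect` — the one-anchor TANGENT CAP of
  `energyDensityTT'_le_of_forall_isTorusLimitOf_slopes` (certified energy cap `R` and slope windows
  `[dlo, dhi]` for the double occupancy, `[τlo, τhi]` for the diagonal kinetic energy over the
  torus-limit ground states at the anchor `(t'₀, U₀)`) read on a whole RECTANGLE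
  `[s₁, s₂] × [U₁, U₂]` of the `(t', U)` half-plane: the sign-split affine majorant is convex
  piecewise-linear, so its maximum over the rectangle is a maximum over corner values
  (`sub_mul_le_max_endpoints`, `max_sub_mul_le_cornerMax`) — a cell CAP word from one anchor, by
  interval arithmetic only.
* §2 `energyDensityTT'_mem_Icc_of_gridCells` — two-sided energy window on a delivered `(t', U)` box
  from per-cell windows (fixed `t`, `n`).
* §3 `forall_groundStates_le_of_gridCells` — a floor `F₀ ≤ obs ω` for EVERY torus-limit ground
  state `ω` at EVERY point of a delivered `(t', U)` box, from per-cell floors (any real functional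
  `obs` of the infinite-volume state: `Re ω(X)`, a `D₄`-orbit mean, a mean energy);
  `forall_groundStates_le_of_gridCells₃` — the same with the DENSITY as a third box coordinate
  (coordinates ordered `(U, t', n)` as in the router's box grammar), i.e. the shape of the cuprate-box
  word.

* §4 THREE-COORDINATE ENERGY CELLS `[s₁, s₂] × [U₁, U₂] × [n₁, n₂]` (joint concavity in `(t', U)` ×
  convexity in `n`): `energyDensityTT'_box₃_ge_min` — floors uniform over the filling interval at the four
  `(t', U)`-corners (filling-box toolkit `HubbardFillingBoxEnergyBounds`) give the corner-min floor on the
  whole 3-D cell; `energyDensityTT'_box₃_le_max` — rectangle caps at the two filling endpoints give the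
  cap `max C₁ C₂` on the whole 3-D cell; `energyDensityTT'_box₃_mem_Icc` — both.
* §5 ONE ANCHOR ⇒ RECTANGLE, word-free: a certified window `[L, R]` at one point `(s₀, U₀)` is a window
  on every rectangle of the `(t', U)` half-plane, degraded by the tree's Lipschitz constants `4n` (in
  `t'`) and `(n/2)²` (in `U`, one-sided by monotonicity) evaluated at the rectangle's far edges
  (`abs_sub_le_max_of_mem_Icc`, `energyDensityTT'_rect_ge_of_anchor`, `energyDensityTT'_rect_le_of_anchor`,
  `energyDensityTT'_rect_mem_Icc_of_anchor`) — the fallback cell word where no second anchor exists; with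
  certified slope words at the anchor the cap side is §1 instead.

* §6 THE T4′ CELL FLOOR READ AT EVERY POINT OF A RECTANGULAR CELL:
  `IsTorusLimitOf.re_expect_ge_cellFloor_of_window_certificates_TT'_ineq_on_rect` — four corner window
  certificates of a rectangle `[s₁, s₂] × [U₁, U₂]` (per-corner `κ`, eom generators, Gram data, word
  coefficients; reference coupling charges with radii `rt`, `rU`) and ONE energy cap `C` uniform on the
  rectangle (e.g. §1 or §5) give `F − ((s₂−s₁)/2·Σ rt + (U₂−U₁)/2·Σ rU) ≤ Re ω_{Λ'}(X)` for EVERY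
  torus-limit ground state `ω` at EVERY point of the closed rectangle (the hull form
  `…_cellFloor_…_at` of `BoxDualCovarianceCombination` + the product weights of `BoxCovering`); this is
  the cell word of the `p402471` class in the shape §3 / the covering rule consume.

* §7 RECTANGLE WINDOW FROM ONE ANCHOR COLUMN AND THE BOX'S ENDPOINT `K₂` WORDS (joint assembly of the
  `t'`-transport of `HubbardTTPrimeDiagHopTransport` §5 with monotonicity in `U`): a floor row at
  `(s₀, U₁)` plus the diagonal-kinetic-energy words `K₂ ≤ A₁` at `(s₁, U₁)`, `B₁ ≤ K₂` at `(s₂, U₁)` floor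
  the whole rectangle `[s₁, s₂] × [U₁, U₂]` by `L + min 0 (min (B₁(s₂−s₀)) (−A₁(s₀−s₁)))`; a cap row at
  `(s₀, U₂)` plus the words at `(s₁, U₂)`, `(s₂, U₂)` cap it by `R + max 0 (max (A₂(s₂−s₀)) (−B₂(s₀−s₁)))`
  (`energyDensityTT'_rect_ge/le/mem_Icc_of_anchor_endpointWords`) — two rows + four cheap one-body
  words per cell, no docc word, no transport loss in `U`.

What is NOT here: how cell words are produced; the single-coordinate transport lemmas themselves
(region toolkit, filling-box files, `U`-box / `t'`-box word files); `n`-extent certificates (`…_nbox`,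
`…_nChord`); any phase sentence.

## Mathlib / tree search

Tree: `ThermodynamicLimit.energyDensityTT'_le_of_forall_isTorusLimitOf_slopes` (point form of §1),
`BoxCovering.exists_gridCell₂_of_mem`, `BoxCovering.exists_gridCell_of_mem_Icc`,
`BoxCovering.le_of_forall_gridCells₂` (generic covering); `lean search 'on_rect|gridCells|slopes_on'`
in `Literature/MathematicalPhysics`: nothing prior.

## References

* A. Neumaier, Acta Numerica 13 (2004) 271–369, §12 (sub-boxes whose union is the box; per-sub-box
  bounds), §11 (interval evaluation over boxes). [cite: Neumaier2004CompleteSearch, §12]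
* R. B. Israel, *Convexity in the Theory of Lattice Gases* (1979), Thm. I.3.4 (concavity of the
  energy density in linear couplings: tangent functionals are global majorants).
  [cite: Israel1979, Thm. I.3.4]
* T. Koma, H. Tasaki, J. Stat. Phys. 76 (1994) 745, §1. [cite: KomaTasaki1994, §1]
-/

noncomputable section

namespace Literature.MathematicalPhysics.QuantumLattice

open Matrix Finset HubbardWave0 Literature.Probability.LatticeModels ThermodynamicLimit
open Literature.Computation.Certificates
open _root_.Filter
open scoped _root_.Topology ComplexOrder BigOperators

namespace ThermodynamicLimit

open InfVolFermionState

/-! ### §1 The one-anchor tangent cap over a rectangle (interval extension of the sign-split majorant) -/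

/-- An affine function of `U` on `[U₁, U₂]` is below the larger of its endpoint values:
`(U − U₀) d ≤ max ((U₁ − U₀) d) ((U₂ − U₀) d)`. [cite: Neumaier2004CompleteSearch, §11] -/
theorem sub_mul_le_max_endpoints {U U₀ U₁ U₂ d : ℝ} (h₁ : U₁ ≤ U) (h₂ : U ≤ U₂) :
    (U - U₀) * d ≤ max ((U₁ - U₀) * d) ((U₂ - U₀) * d) := by
  rcases le_total 0 d with hd | hd
  · exact (mul_le_mul_of_nonneg_right (by linarith) hd).trans (le_max_right _ _)
  · exact (mul_le_mul_of_nonpos_right (by linarith) hd).trans (le_max_left _ _)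

/-- The sign-split slope term `max ((U − U₀) dlo) ((U − U₀) dhi)` over `U ∈ [U₁, U₂]` is below its
corner maximum `max (max ((U₁−U₀)dlo) ((U₂−U₀)dlo)) (max ((U₁−U₀)dhi) ((U₂−U₀)dhi))` (a convex
piecewise-linear function attains its maximum over a segment at an endpoint).
[cite: Neumaier2004CompleteSearch, §11] -/
theorem max_sub_mul_le_cornerMax {U U₀ U₁ U₂ dlo dhi : ℝ} (h₁ : U₁ ≤ U) (h₂ : U ≤ U₂) :
    max ((U - U₀) * dlo) ((U - U₀) * dhi) ≤
      max (max ((U₁ - U₀) * dlo) ((U₂ - U₀) * dlo)) (max ((U₁ - U₀) * dhi) ((U₂ - U₀) * dhi)) :=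
  max_le_max (sub_mul_le_max_endpoints h₁ h₂) (sub_mul_le_max_endpoints h₁ h₂)

/-- **One-anchor tangent cap on a rectangle.** With the hypothesis package of
`energyDensityTT'_le_of_forall_isTorusLimitOf_slopes` at the anchor `(t'₀, U₀)` (`U₀ ≥ 0`,
`0 ≤ n < 2`; certified cap `e(t,t'₀,U₀,n) ≤ R`; windows `[dlo, dhi]` for `Re ω(n₀↑n₀↓)` and
`[τlo, τhi]` for the diagonal mean energy `e_{Φ(0,1,0)}(ω)` over all torus-limit ground states `ω`
there), every point `(t', U)` of a rectangle `[s₁, s₂] × [U₁, U₂]` with `U₁ ≥ 0` satisfies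
`e(t,t',U,n) ≤ R + M_U + M_{t'}`, where `M_U`, `M_{t'}` are the corner maxima of the sign-split slope
terms — ONE number caps the whole cell. [cite: Israel1979, Thm. I.3.4] -/
theorem energyDensityTT'_le_of_forall_isTorusLimitOf_slopes_on_rect (t t'₀ : ℝ) {U₀ : ℝ}
    (hU₀ : 0 ≤ U₀) {n : ℝ} (hn0 : 0 ≤ n) (hn2 : n < 2) {R dlo dhi τlo τhi : ℝ}
    (hR : energyDensityTT' t t'₀ U₀ n ≤ R)
    (hslopes : ∀ (ω : InfVolFermionState 2) (Ls : ℕ → ℕ) (ψ : ∀ L, Fock (Orb (FermionTorus 2 L))),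
      Tendsto Ls atTop atTop →
      (∀ j, IsGroundStateInSector (hubbardTorusTT' (Ls j) t t'₀ U₀) (rectN n (Ls j)) 0 (ψ (Ls j))) →
      (∀ j, star (ψ (Ls j)) ⬝ᵥ ψ (Ls j) = 1) → ω.IsTorusLimitOf ψ Ls →
      dlo ≤ (ω.expect ({0} : Finset (Site 2))
          (nAt 0 (Finset.mem_singleton_self 0) 0 * nAt 0 (Finset.mem_singleton_self 0) 1)).re ∧
        (ω.expect ({0} : Finset (Site 2))
          (nAt 0 (Finset.mem_singleton_self 0) 0 * nAt 0 (Finset.mem_singleton_self 0) 1)).re ≤ dhi ∧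
        τlo ≤ ω.meanEnergy (hubbardTTPrimeFermionInteraction 0 1 0) 1 ∧
        ω.meanEnergy (hubbardTTPrimeFermionInteraction 0 1 0) 1 ≤ τhi)
    {s₁ s₂ U₁ U₂ : ℝ} (hU₁ : 0 ≤ U₁) {t' U : ℝ} (hs₁ : s₁ ≤ t') (hs₂ : t' ≤ s₂) (hU₁' : U₁ ≤ U)
    (hU₂ : U ≤ U₂) :
    energyDensityTT' t t' U n ≤
      R + max (max ((U₁ - U₀) * dlo) ((U₂ - U₀) * dlo)) (max ((U₁ - U₀) * dhi) ((U₂ - U₀) * dhi)) +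
        max (max ((s₁ - t'₀) * τlo) ((s₂ - t'₀) * τlo)) (max ((s₁ - t'₀) * τhi) ((s₂ - t'₀) * τhi)) := by
  have h := energyDensityTT'_le_of_forall_isTorusLimitOf_slopes t t'₀ hU₀ hn0 hn2 hR hslopes t'
    (hU₁.trans hU₁')
  have h1 := max_sub_mul_le_cornerMax (U₀ := U₀) (dlo := dlo) (dhi := dhi) hU₁' hU₂
  have h2 := max_sub_mul_le_cornerMax (U₀ := t'₀) (dlo := τlo) (dhi := τhi) hs₁ hs₂
  linarith

/-! ### §2 Energy window on a delivered `(t', U)` box from grid-cell windows -/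

/-- **Energy window of a delivered box.** Fixed `t`, `n`; a grid of the `(t', U)` plane with
breakpoints `s 0, …, s M` and `u 0, …, u K` (`0 < M`, `0 < K`); on every grid rectangle a certified
window `ℓ i j ≤ e(t,t',U,n) ≤ r i j`; a delivered box `[a₁, a₂] × [b₁, b₂]` inside the gridded extent
(`s 0 ≤ a₁`, `a₂ ≤ s M`, `u 0 ≤ b₁`, `b₂ ≤ u K`) and constants `ℓ₀ ≤ ℓ i j`, `r i j ≤ r₀`: then
`ℓ₀ ≤ e(t,t',U,n) ≤ r₀` at every point of the delivered box. [cite: Neumaier2004CompleteSearch, §12] -/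
theorem energyDensityTT'_mem_Icc_of_gridCells (t n : ℝ) {s u : ℕ → ℝ} {M K : ℕ} (hM : 0 < M)
    (hK : 0 < K) {a₁ a₂ b₁ b₂ : ℝ} (ha : s 0 ≤ a₁) (ha' : a₂ ≤ s M) (hb : u 0 ≤ b₁) (hb' : b₂ ≤ u K)
    (ℓ r : ℕ → ℕ → ℝ) {ℓ₀ r₀ : ℝ} (hℓ₀ : ∀ i < M, ∀ j < K, ℓ₀ ≤ ℓ i j)
    (hr₀ : ∀ i < M, ∀ j < K, r i j ≤ r₀)
    (hcell : ∀ i < M, ∀ j < K, ∀ t' U : ℝ, s i ≤ t' → t' ≤ s (i + 1) → u j ≤ U → U ≤ u (j + 1) →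
      ℓ i j ≤ energyDensityTT' t t' U n ∧ energyDensityTT' t t' U n ≤ r i j)
    {t' U : ℝ} (h₁ : a₁ ≤ t') (h₂ : t' ≤ a₂) (h₃ : b₁ ≤ U) (h₄ : U ≤ b₂) :
    energyDensityTT' t t' U n ∈ Set.Icc ℓ₀ r₀ :=
  ⟨BoxCovering.le_of_forall_gridCells₂ hM hK ha ha' hb hb' (fun x y => energyDensityTT' t x y n) ℓ hℓ₀
      (fun i hi j hj x y hx hx' hy hy' => (hcell i hi j hj x y hx hx' hy hy').1) h₁ h₂ h₃ h₄,
    BoxCovering.ge_of_forall_gridCells₂ hM hK ha ha' hb hb' (fun x y => energyDensityTT' t x y n) r hr₀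
      (fun i hi j hj x y hx hx' hy hy' => (hcell i hi j hj x y hx hx' hy hy').2) h₁ h₂ h₃ h₄⟩

/-! ### §3 Ground-state observable floors on a delivered box from grid-cell floors -/

/-- **Observable floor over all torus-limit ground states of a delivered `(t', U)` box.** Fixed `t`,
`n`; `obs` any real functional of the infinite-volume state (e.g. `ω ↦ Re ω_{Λ'}(X)`, a `D₄`-orbit mean,
a mean energy). If on every grid rectangle `[s i, s (i+1)] × [u j, u (j+1)]` the floor `Fl i j ≤ obs ω`
is certified for EVERY torus-limit ground state `ω` at EVERY point of the rectangle, and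
`F₀ ≤ Fl i j`, then `F₀ ≤ obs ω` for every torus-limit ground state at every point of a delivered box
inside the gridded extent. [cite: Neumaier2004CompleteSearch, §12] -/
theorem forall_groundStates_le_of_gridCells (t n : ℝ) {s u : ℕ → ℝ} {M K : ℕ} (hM : 0 < M)
    (hK : 0 < K) {a₁ a₂ b₁ b₂ : ℝ} (ha : s 0 ≤ a₁) (ha' : a₂ ≤ s M) (hb : u 0 ≤ b₁) (hb' : b₂ ≤ u K)
    (obs : InfVolFermionState 2 → ℝ) (Fl : ℕ → ℕ → ℝ) {F₀ : ℝ}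
    (hF₀ : ∀ i < M, ∀ j < K, F₀ ≤ Fl i j)
    (hcell : ∀ i < M, ∀ j < K, ∀ t' U : ℝ, s i ≤ t' → t' ≤ s (i + 1) → u j ≤ U → U ≤ u (j + 1) →
      ∀ (ω : InfVolFermionState 2) (Ls : ℕ → ℕ) (ψ : ∀ L, Fock (Orb (FermionTorus 2 L))),
        Tendsto Ls atTop atTop →
        (∀ l, IsGroundStateInSector (hubbardTorusTT' (Ls l) t t' U) (rectN n (Ls l)) 0 (ψ (Ls l))) →
        (∀ l, star (ψ (Ls l)) ⬝ᵥ ψ (Ls l) = 1) → ω.IsTorusLimitOf ψ Ls → Fl i j ≤ obs ω)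
    {t' U : ℝ} (h₁ : a₁ ≤ t') (h₂ : t' ≤ a₂) (h₃ : b₁ ≤ U) (h₄ : U ≤ b₂)
    {ω : InfVolFermionState 2} {Ls : ℕ → ℕ} {ψ : ∀ L, Fock (Orb (FermionTorus 2 L))}
    (hLs : Tendsto Ls atTop atTop)
    (hψ : ∀ l, IsGroundStateInSector (hubbardTorusTT' (Ls l) t t' U) (rectN n (Ls l)) 0 (ψ (Ls l)))
    (hψ1 : ∀ l, star (ψ (Ls l)) ⬝ᵥ ψ (Ls l) = 1) (hω : ω.IsTorusLimitOf ψ Ls) : F₀ ≤ obs ω := by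
  obtain ⟨i, hi, j, hj, hx, hy⟩ := BoxCovering.exists_gridCell₂_of_mem hM hK (ha.trans h₁)
    (h₂.trans ha') (hb.trans h₃) (h₄.trans hb')
  exact (hF₀ i hi j hj).trans (hcell i hi j hj t' U hx.1 hx.2 hy.1 hy.2 ω Ls ψ hLs hψ hψ1 hω)

/-- **Observable floor on a delivered three-coordinate box `(U, t', n)`** (the router's box grammar
orders the single-band coordinates `U/t, t'/t, n`; units `t` fixed). Per coordinate a breakpoint list
`g k 0, …, g k (N k)` (`0 < N k`); on every grid cell `j` a floor `Fl j ≤ obs ω` certified for every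
torus-limit ground state `ω` of `H(t, θ 1, θ 0)` at density `θ 2`, for every `θ` in the cell (such
density-extent cell words come from `…_nbox` / `…_nChord`-type certificates); a delivered box
`Set.Icc lo hi` (e.g. `lo = (7.5, −0.30, 0.865)`, `hi = (8.5, −0.20, 0.885)`) inside the gridded
extent; `F₀ ≤ Fl j`. Then `F₀ ≤ obs ω` for every torus-limit ground state at every `θ` of the box.
[cite: Neumaier2004CompleteSearch, §12] -/
theorem forall_groundStates_le_of_gridCells₃ (t : ℝ) (g : Fin 3 → ℕ → ℝ) (N : Fin 3 → ℕ)
    (hN : ∀ k, 0 < N k) {lo hi : Fin 3 → ℝ} (hlo : ∀ k, g k 0 ≤ lo k) (hhi : ∀ k, hi k ≤ g k (N k))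
    (obs : InfVolFermionState 2 → ℝ) (Fl : (Fin 3 → ℕ) → ℝ) {F₀ : ℝ}
    (hF₀ : ∀ j : Fin 3 → ℕ, (∀ k, j k < N k) → F₀ ≤ Fl j)
    (hcell : ∀ j : Fin 3 → ℕ, (∀ k, j k < N k) →
      ∀ θ ∈ Set.Icc (fun k => g k (j k)) (fun k => g k (j k + 1)),
      ∀ (ω : InfVolFermionState 2) (Ls : ℕ → ℕ) (ψ : ∀ L, Fock (Orb (FermionTorus 2 L))),
        Tendsto Ls atTop atTop →
        (∀ l, IsGroundStateInSector (hubbardTorusTT' (Ls l) t (θ 1) (θ 0)) (rectN (θ 2) (Ls l)) 0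
          (ψ (Ls l))) →
        (∀ l, star (ψ (Ls l)) ⬝ᵥ ψ (Ls l) = 1) → ω.IsTorusLimitOf ψ Ls → Fl j ≤ obs ω)
    {θ : Fin 3 → ℝ} (hθ : θ ∈ Set.Icc lo hi)
    {ω : InfVolFermionState 2} {Ls : ℕ → ℕ} {ψ : ∀ L, Fock (Orb (FermionTorus 2 L))}
    (hLs : Tendsto Ls atTop atTop)
    (hψ : ∀ l, IsGroundStateInSector (hubbardTorusTT' (Ls l) t (θ 1) (θ 0)) (rectN (θ 2) (Ls l)) 0
      (ψ (Ls l)))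
    (hψ1 : ∀ l, star (ψ (Ls l)) ⬝ᵥ ψ (Ls l) = 1) (hω : ω.IsTorusLimitOf ψ Ls) : F₀ ≤ obs ω := by
  obtain ⟨j, hj, hmem⟩ := BoxCovering.exists_gridCell_of_mem_Icc g N hN hlo hhi hθ
  exact (hF₀ j hj).trans (hcell j hj θ hmem ω Ls ψ hLs hψ hψ1 hω)

/-! ### §4 Three-coordinate energy cells `[s₁, s₂] × [U₁, U₂] × [n₁, n₂]` -/

/-- **3-D cell FLOOR = corner minimum.** A rectangle `[s₁, s₂] × [U₁, U₂]` of the `(t', U)` half-plane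
(`0 ≤ U₁`, `s₁ < s₂`, `U₁ < U₂`) times a filling interval `[n₁, n₂] ⊂ [0, 2)`; at each of the four
`(t', U)`-corners a floor UNIFORM over the filling interval (`∀ n ∈ [n₁, n₂], L ≤ e(t, corner, n)` — the
output of the filling-box toolkit: secant extensions, supporting lines). Then the smallest corner floor
bounds `e` from below on the whole 3-D cell (joint concavity in `(t', U)` at each fixed density:
`energyDensityTT'_box_ge_min`). [cite: Israel1979, Thm. I.3.4] -/
theorem energyDensityTT'_box₃_ge_min (t : ℝ) {s₁ s₂ U₁ U₂ n₁ n₂ : ℝ} (hU₁ : 0 ≤ U₁) (hs : s₁ < s₂)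
    (hU : U₁ < U₂) (hn₁ : 0 ≤ n₁) (hn₂ : n₂ < 2) {L₁₁ L₁₂ L₂₁ L₂₂ : ℝ}
    (h₁₁ : ∀ n ∈ Set.Icc n₁ n₂, L₁₁ ≤ energyDensityTT' t s₁ U₁ n)
    (h₁₂ : ∀ n ∈ Set.Icc n₁ n₂, L₁₂ ≤ energyDensityTT' t s₁ U₂ n)
    (h₂₁ : ∀ n ∈ Set.Icc n₁ n₂, L₂₁ ≤ energyDensityTT' t s₂ U₁ n)
    (h₂₂ : ∀ n ∈ Set.Icc n₁ n₂, L₂₂ ≤ energyDensityTT' t s₂ U₂ n)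
    {s U n : ℝ} (hs₁ : s₁ ≤ s) (hs₂ : s ≤ s₂) (hU₁' : U₁ ≤ U) (hU₂ : U ≤ U₂)
    (hn : n ∈ Set.Icc n₁ n₂) :
    min (min L₁₁ L₁₂) (min L₂₁ L₂₂) ≤ energyDensityTT' t s U n :=
  energyDensityTT'_box_ge_min t (hn₁.trans hn.1) (lt_of_le_of_lt hn.2 hn₂) hU₁ hs hU hs₁ hs₂ hU₁' hU₂
    (h₁₁ n hn) (h₁₂ n hn) (h₂₁ n hn) (h₂₂ n hn)

/-- **3-D cell CAP = the larger endpoint cap.** Caps `C₁`, `C₂` uniform over the rectangle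
`[s₁, s₂] × [U₁, U₂]` (`0 ≤ U₁`) at the two filling endpoints `n₁ ≤ n₂` (`0 ≤ n₁`, `n₂ < 2`) — e.g. the
one-anchor tangent caps of §1 — give `e ≤ max C₁ C₂` on the whole 3-D cell (convexity in the density at
each fixed coupling: `energyDensityTT'_le_max_of_mem_Icc`). [cite: Neumaier2004CompleteSearch, §12] -/
theorem energyDensityTT'_box₃_le_max (t : ℝ) {s₁ s₂ U₁ U₂ n₁ n₂ C₁ C₂ : ℝ} (hU₁ : 0 ≤ U₁)
    (hn₁ : 0 ≤ n₁) (hn₂ : n₂ < 2)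
    (hC₁ : ∀ s U : ℝ, s₁ ≤ s → s ≤ s₂ → U₁ ≤ U → U ≤ U₂ → energyDensityTT' t s U n₁ ≤ C₁)
    (hC₂ : ∀ s U : ℝ, s₁ ≤ s → s ≤ s₂ → U₁ ≤ U → U ≤ U₂ → energyDensityTT' t s U n₂ ≤ C₂)
    {s U n : ℝ} (hs₁ : s₁ ≤ s) (hs₂ : s ≤ s₂) (hU₁' : U₁ ≤ U) (hU₂ : U ≤ U₂)
    (hn : n ∈ Set.Icc n₁ n₂) : energyDensityTT' t s U n ≤ max C₁ C₂ :=
  energyDensityTT'_le_max_of_mem_Icc t s (hU₁.trans hU₁') hn₁ hn₂ (hC₁ s U hs₁ hs₂ hU₁' hU₂)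
    (hC₂ s U hs₁ hs₂ hU₁' hU₂) hn

/-- **3-D cell WINDOW** (`energyDensityTT'_box₃_ge_min` and `energyDensityTT'_box₃_le_max` together): the
energy word of one certified `(t', U, n)`-cell, from four filling-uniform corner floors and two
rectangle-uniform endpoint caps. [cite: Neumaier2004CompleteSearch, §12] -/
theorem energyDensityTT'_box₃_mem_Icc (t : ℝ) {s₁ s₂ U₁ U₂ n₁ n₂ : ℝ} (hU₁ : 0 ≤ U₁) (hs : s₁ < s₂)
    (hU : U₁ < U₂) (hn₁ : 0 ≤ n₁) (hn₂ : n₂ < 2) {L₁₁ L₁₂ L₂₁ L₂₂ C₁ C₂ : ℝ}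
    (h₁₁ : ∀ n ∈ Set.Icc n₁ n₂, L₁₁ ≤ energyDensityTT' t s₁ U₁ n)
    (h₁₂ : ∀ n ∈ Set.Icc n₁ n₂, L₁₂ ≤ energyDensityTT' t s₁ U₂ n)
    (h₂₁ : ∀ n ∈ Set.Icc n₁ n₂, L₂₁ ≤ energyDensityTT' t s₂ U₁ n)
    (h₂₂ : ∀ n ∈ Set.Icc n₁ n₂, L₂₂ ≤ energyDensityTT' t s₂ U₂ n)
    (hC₁ : ∀ s U : ℝ, s₁ ≤ s → s ≤ s₂ → U₁ ≤ U → U ≤ U₂ → energyDensityTT' t s U n₁ ≤ C₁)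
    (hC₂ : ∀ s U : ℝ, s₁ ≤ s → s ≤ s₂ → U₁ ≤ U → U ≤ U₂ → energyDensityTT' t s U n₂ ≤ C₂)
    {s U n : ℝ} (hs₁ : s₁ ≤ s) (hs₂ : s ≤ s₂) (hU₁' : U₁ ≤ U) (hU₂ : U ≤ U₂)
    (hn : n ∈ Set.Icc n₁ n₂) :
    energyDensityTT' t s U n ∈ Set.Icc (min (min L₁₁ L₁₂) (min L₂₁ L₂₂)) (max C₁ C₂) :=
  ⟨energyDensityTT'_box₃_ge_min t hU₁ hs hU hn₁ hn₂ h₁₁ h₁₂ h₂₁ h₂₂ hs₁ hs₂ hU₁' hU₂ hn,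
    energyDensityTT'_box₃_le_max t hU₁ hn₁ hn₂ hC₁ hC₂ hs₁ hs₂ hU₁' hU₂ hn⟩

/-! ### §5 One anchor ⇒ a whole rectangle, by the Lipschitz constants (word-free fallback) -/

/-- `|s − s₀| ≤ max |s₁ − s₀| |s₂ − s₀|` for `s ∈ [s₁, s₂]` (the distance to a fixed point is convex, so
its maximum over a segment is at an endpoint). [cite: Neumaier2004CompleteSearch, §11] -/
theorem abs_sub_le_max_of_mem_Icc {s s₀ s₁ s₂ : ℝ} (h₁ : s₁ ≤ s) (h₂ : s ≤ s₂) :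
    |s - s₀| ≤ max |s₁ - s₀| |s₂ - s₀| := by
  rcases le_total s₀ s with h | h
  · rw [abs_of_nonneg (sub_nonneg.2 h)]
    exact le_trans (by linarith) ((le_abs_self (s₂ - s₀)).trans (le_max_right _ _))
  · rw [abs_of_nonpos (sub_nonpos.2 h)]
    exact le_trans (by linarith) ((neg_le_abs (s₁ - s₀)).trans (le_max_left _ _))

/-- **One-anchor rectangle FLOOR, word-free.** A certified floor `L ≤ e(t, s₀, U₀, n)` at ONE coupling
point (`U₀ ≥ 0`, `0 ≤ n < 2`) is a floor on every rectangle `[s₁, s₂] × [U₁, U₂]` (`U₁ ≥ 0`) of the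
`(t', U)` half-plane, degraded by `4n · max |s₁ − s₀| |s₂ − s₀|` (Lipschitz in `t'`,
`energyDensityTT'_ge_of_lowerBound_tPrime`) and by `(n/2)² · max (U₀ − U₁) 0` (downward Lipschitz in `U`,
`energyDensityTT'_ge_sub_mul_sq_U`; upward in `U` the energy only grows, `energyDensityTT'_mono_U`).
[cite: Israel1979, Thm. I.3.4] -/
theorem energyDensityTT'_rect_ge_of_anchor (t : ℝ) {n : ℝ} (hn0 : 0 ≤ n) (hn2 : n < 2) {s₀ U₀ L : ℝ}
    (hU₀ : 0 ≤ U₀) (hL : L ≤ energyDensityTT' t s₀ U₀ n) {s₁ s₂ U₁ U₂ : ℝ} (hU₁ : 0 ≤ U₁)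
    {s U : ℝ} (hs₁ : s₁ ≤ s) (hs₂ : s ≤ s₂) (hU₁' : U₁ ≤ U) (_hU₂ : U ≤ U₂) :
    L - 4 * n * max |s₁ - s₀| |s₂ - s₀| - (n / 2) ^ 2 * max (U₀ - U₁) 0 ≤
      energyDensityTT' t s U n := by
  -- `t'`-leg at `U₀`
  have h1 : L - 4 * n * |s - s₀| ≤ energyDensityTT' t s U₀ n :=
    energyDensityTT'_ge_of_lowerBound_tPrime t hU₀ hn0 hn2 hL
  have hmax : |s - s₀| ≤ max |s₁ - s₀| |s₂ - s₀| := abs_sub_le_max_of_mem_Icc hs₁ hs₂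
  have h1' : L - 4 * n * max |s₁ - s₀| |s₂ - s₀| ≤ energyDensityTT' t s U₀ n :=
    le_trans (by nlinarith [hmax, hn0]) h1
  have hsq : 0 ≤ (n / 2) ^ 2 := sq_nonneg _
  have hU0 : 0 ≤ U := hU₁.trans hU₁'
  -- `U`-leg at `t' = s`
  rcases le_total U₀ U with hle | hle
  · have h2 := energyDensityTT'_mono_U t s hn0 hn2 hU₀ hle
    have h3 : 0 ≤ (n / 2) ^ 2 * max (U₀ - U₁) 0 := mul_nonneg hsq (le_max_right _ _)
    linarith
  · have h2 := energyDensityTT'_ge_sub_mul_sq_U t s hn0 hn2 hU0 hle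
    have h3 : (U₀ - U) * (n / 2) ^ 2 ≤ (n / 2) ^ 2 * max (U₀ - U₁) 0 := by
      rw [mul_comm]
      exact mul_le_mul_of_nonneg_left (le_trans (by linarith) (le_max_left _ _)) hsq
    linarith

/-- **One-anchor rectangle CAP, word-free.** A certified cap `e(t, s₀, U₀, n) ≤ R` at ONE coupling point
(`U₀ ≥ 0`, `0 ≤ n < 2`) is a cap on every rectangle `[s₁, s₂] × [U₁, U₂]` (`U₁ ≥ 0`), degraded by
`4n · max |s₁ − s₀| |s₂ − s₀|` and by `(n/2)² · max (U₂ − U₀) 0` (`energyDensityTT'_le_of_upperBound_tPrime`,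
`abs_energyDensityTT'_sub_U_le`, `energyDensityTT'_mono_U`). With certified slope words at the anchor,
`energyDensityTT'_le_of_forall_isTorusLimitOf_slopes_on_rect` (§1) is the sharper cap.
[cite: Israel1979, Thm. I.3.4] -/
theorem energyDensityTT'_rect_le_of_anchor (t : ℝ) {n : ℝ} (hn0 : 0 ≤ n) (hn2 : n < 2) {s₀ U₀ R : ℝ}
    (hU₀ : 0 ≤ U₀) (hR : energyDensityTT' t s₀ U₀ n ≤ R) {s₁ s₂ U₁ U₂ : ℝ} (hU₁ : 0 ≤ U₁)
    {s U : ℝ} (hs₁ : s₁ ≤ s) (hs₂ : s ≤ s₂) (hU₁' : U₁ ≤ U) (hU₂ : U ≤ U₂) :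
    energyDensityTT' t s U n ≤
      R + 4 * n * max |s₁ - s₀| |s₂ - s₀| + (n / 2) ^ 2 * max (U₂ - U₀) 0 := by
  -- `t'`-leg at `U₀`
  have h1 : energyDensityTT' t s U₀ n ≤ R + 4 * n * |s - s₀| :=
    energyDensityTT'_le_of_upperBound_tPrime t hU₀ hn0 hn2 hR
  have hmax : |s - s₀| ≤ max |s₁ - s₀| |s₂ - s₀| := abs_sub_le_max_of_mem_Icc hs₁ hs₂
  have h1' : energyDensityTT' t s U₀ n ≤ R + 4 * n * max |s₁ - s₀| |s₂ - s₀| :=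
    h1.trans (by nlinarith [hmax, hn0])
  have hsq : 0 ≤ (n / 2) ^ 2 := sq_nonneg _
  have hU0 : 0 ≤ U := hU₁.trans hU₁'
  -- `U`-leg at `t' = s`
  rcases le_total U U₀ with hle | hle
  · have h2 := energyDensityTT'_mono_U t s hn0 hn2 hU0 hle
    have h3 : 0 ≤ (n / 2) ^ 2 * max (U₂ - U₀) 0 := mul_nonneg hsq (le_max_right _ _)
    linarith
  · have h2 := abs_energyDensityTT'_sub_U_le t s hn0 hn2 hU0 hU₀
    rw [abs_of_nonneg (sub_nonneg.2 hle)] at h2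
    have h2' := (le_abs_self _).trans h2
    have h3 : (U - U₀) * (n / 2) ^ 2 ≤ (n / 2) ^ 2 * max (U₂ - U₀) 0 := by
      rw [mul_comm]
      exact mul_le_mul_of_nonneg_left (le_trans (by linarith) (le_max_left _ _)) hsq
    linarith

/-- **One-anchor rectangle WINDOW, word-free**: the certified point window `[L, R]` at `(s₀, U₀)` read on a
whole rectangle (`energyDensityTT'_rect_ge_of_anchor` and `energyDensityTT'_rect_le_of_anchor`).
[cite: Israel1979, Thm. I.3.4] -/
theorem energyDensityTT'_rect_mem_Icc_of_anchor (t : ℝ) {n : ℝ} (hn0 : 0 ≤ n) (hn2 : n < 2)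
    {s₀ U₀ L R : ℝ} (hU₀ : 0 ≤ U₀) (hL : L ≤ energyDensityTT' t s₀ U₀ n)
    (hR : energyDensityTT' t s₀ U₀ n ≤ R) {s₁ s₂ U₁ U₂ : ℝ} (hU₁ : 0 ≤ U₁)
    {s U : ℝ} (hs₁ : s₁ ≤ s) (hs₂ : s ≤ s₂) (hU₁' : U₁ ≤ U) (hU₂ : U ≤ U₂) :
    energyDensityTT' t s U n ∈
      Set.Icc (L - 4 * n * max |s₁ - s₀| |s₂ - s₀| - (n / 2) ^ 2 * max (U₀ - U₁) 0)
        (R + 4 * n * max |s₁ - s₀| |s₂ - s₀| + (n / 2) ^ 2 * max (U₂ - U₀) 0) :=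
  ⟨energyDensityTT'_rect_ge_of_anchor t hn0 hn2 hU₀ hL hU₁ hs₁ hs₂ hU₁' hU₂,
    energyDensityTT'_rect_le_of_anchor t hn0 hn2 hU₀ hR hU₁ hs₁ hs₂ hU₁' hU₂⟩

end ThermodynamicLimit

/-! ### §6 The T4′ cell floor read at every point of a rectangular cell -/

section CellFloorOnRect

open Literature.MathematicalPhysics.QuantumManyBody.StateRelaxation

/-- **T4′ cell floor at EVERY point of a rectangle.** Corner window certificates at the four corners
`(![s₁, s₂] a, ![U₁, U₂] b)`, `(a, b) : Fin 2 × Fin 2`, of a rectangle of the `(t', U)` half-plane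
(`0 ≤ U₁`), with the data of `…re_expect_ge_cellFloor_of_window_certificates_TT'_ineq_at` (shared
objective `X`, `ν`, Gram basis `O`, eom index set, word lists; per-corner `cᵢ, uᵢ, κᵢ ≥ 0, μᵢ, Λmᵢ ⪰ 0, Bᵢ,
Yᵢ, bᵢ, dcᵢ, aᵢ`, θ-free expansions `qt, qU, et, eU` of the coupling charges, reference charges `Ct, CU`
with radii `rt, rU`), ONE energy cap `C` valid on the whole rectangle (`e(t, t', U, n) ≤ C` there — e.g.
`energyDensityTT'_le_of_forall_isTorusLimitOf_slopes_on_rect` or `energyDensityTT'_rect_le_of_anchor`),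
and a floor `F ≤ cᵢ − Σₘ‖aᵢₘ‖ + (Σ_σ μᵢσ)(n/2 − ν) − κᵢ (C − uᵢ)` of the cap-adjusted corner bounds. Then
for EVERY point `(t', U)` of the closed rectangle and every torus-limit ground state `ω` there,
`F − ((s₂ − s₁)/2 · Σₘ rtₘ + (U₂ − U₁)/2 · Σₘ rUₘ) ≤ Re ω_{Λ'}(X)` (the point is a product-weight convex
combination of the corners, `BoxCovering.exists_convexWeights_rectCorners`; with a constant cap the
multiplier-radius term of the hull form vanishes). [cite: WangEtAl2024, §III] -/
theorem InfVolFermionState.IsTorusLimitOf.re_expect_ge_cellFloor_of_window_certificates_TT'_ineq_on_rect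
    (t : ℝ) {s₁ s₂ U₁ U₂ : ℝ} (hU₁ : 0 ≤ U₁) (u c κ : Fin 2 × Fin 2 → ℝ) (C : ℝ)
    (hκ : ∀ i, 0 ≤ κ i) {n : ℝ} (hn0 : 0 ≤ n) (hn2 : n < 2)
    (hC : ∀ tp' U' : ℝ, s₁ ≤ tp' → tp' ≤ s₂ → U₁ ≤ U' → U' ≤ U₂ →
      ThermodynamicLimit.energyDensityTT' t tp' U' n ≤ C)
    {Λ Λ' : Finset (Site 2)} (hΛ : Λ ⊆ Λ') (h8 : thicken Λ 1 ⊆ Λ')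
    (h0 : thicken ({0} : Finset (Site 2)) 1 ⊆ Λ') (hz : (0 : Site 2) ∈ Λ')
    (Xw : FermionOp Λ') (μ : Fin 2 × Fin 2 → Fin 2 → ℝ) (ν : ℝ)
    {m : Type*} [Fintype m] [DecidableEq m] (Λm : Fin 2 × Fin 2 → Matrix m m ℂ)
    (hΛm : ∀ i, (Λm i).PosSemidef) (O : m → FermionOp Λ')
    {κ' : Type*} (s : Finset κ') (B : Fin 2 × Fin 2 → κ' → FermionOp Λ)
    {ι : Type*} (tt : Finset ι) (γ : ι → DihedralGroup 4) (hγ1 : ∀ l ∈ tt, γ l = 1) (wv : ι → Site 2)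
    (hsh : ∀ l, d4ShiftSet (γ l) (wv l) Λ ⊆ Λ') (Y : Fin 2 × Fin 2 → ι → FermionOp Λ)
    {ρ : Type*} (uu : Finset ρ) (b : Fin 2 × Fin 2 → ρ → ℂ)
    (cw : ρ → List (Orb (PolySite Λ') × Bool))
    (hcw : ∀ j ∈ uu, ladderCharge (cw j) ≠ 0 ∨ ladderSpinCharge (cw j) ≠ 0)
    {δ : Type*} (ah : Finset δ) (dc : Fin 2 × Fin 2 → δ → ℝ) (V : δ → FermionOp Λ')
    {κ'' : Type*} (wd : Finset κ'') (a : Fin 2 × Fin 2 → κ'' → ℂ)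
    (word : κ'' → List (Orb (PolySite Λ') × Bool))
    (qt qU : Fin 2 × Fin 2 → κ'' → ℂ) (et eU : κ'' → ℂ)
    (hqt : ∀ i, ∑ k ∈ s, ((hubbardTTPrimeFermionInteraction 0 1 0).localHamiltonian Λ' *
          fermionEmbed (PolySite.incl hΛ) (B i k) -
        fermionEmbed (PolySite.incl hΛ) (B i k) *
          (hubbardTTPrimeFermionInteraction 0 1 0).localHamiltonian Λ') =
      ∑ k ∈ wd, qt i k • ladderWord (word k))
    (hqU : ∀ i, ∑ k ∈ s, ((hubbardTTPrimeFermionInteraction 0 0 1).localHamiltonian Λ' *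
          fermionEmbed (PolySite.incl hΛ) (B i k) -
        fermionEmbed (PolySite.incl hΛ) (B i k) *
          (hubbardTTPrimeFermionInteraction 0 0 1).localHamiltonian Λ') =
      ∑ k ∈ wd, qU i k • ladderWord (word k))
    (het : fermionEmbed (PolySite.incl h0) ((hubbardTTPrimeFermionInteraction 0 1 0).meanEnergyObs 1) =
      ∑ k ∈ wd, et k • ladderWord (word k))
    (heU : fermionEmbed (PolySite.incl h0) ((hubbardTTPrimeFermionInteraction 0 0 1).meanEnergyObs 1) =
      ∑ k ∈ wd, eU k • ladderWord (word k))
    (hcert : ∀ i : Fin 2 × Fin 2, Xw - ((c i : ℝ) : ℂ) • (1 : FermionOp Λ') -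
        ∑ σ : Fin 2, ((μ i σ : ℝ) : ℂ) • (nAt 0 hz σ - ((ν : ℝ) : ℂ) • (1 : FermionOp Λ')) -
        ((κ i : ℝ) : ℂ) • (((u i : ℝ) : ℂ) • (1 : FermionOp Λ') -
          fermionEmbed (PolySite.incl h0)
            ((hubbardTTPrimeFermionInteraction t (![s₁, s₂] i.1) (![U₁, U₂] i.2)).meanEnergyObs 1)) =
      gramForm (Λm i) O +
        (∑ k ∈ s, ((hubbardTTPrimeFermionInteraction t (![s₁, s₂] i.1) (![U₁, U₂] i.2)).localHamiltonian
              Λ' * fermionEmbed (PolySite.incl hΛ) (B i k) -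
            fermionEmbed (PolySite.incl hΛ) (B i k) *
              (hubbardTTPrimeFermionInteraction t (![s₁, s₂] i.1) (![U₁, U₂] i.2)).localHamiltonian
                Λ') +
          ∑ l ∈ tt, (fermionEmbed (PolySite.incl (hsh l))
              (fermionEmbed (PolySite.d4Emb (γ l) (wv l) Λ) (Y i l)) -
            fermionEmbed (PolySite.incl hΛ) (Y i l)) +
          ∑ j ∈ uu, b i j • ladderWord (cw j)) +
        (∑ m' ∈ ah, ((dc i m' : ℝ) : ℂ) • ((V m')ᴴ - V m') + ∑ k ∈ wd, a i k • ladderWord (word k)))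
    {F : ℝ} (hF : ∀ i, F ≤ c i - ∑ k ∈ wd, ‖a i k‖ + (∑ σ : Fin 2, μ i σ) * (n / 2 - ν) -
      κ i * (C - u i))
    (Ct CU : κ'' → ℂ) (rt rU : κ'' → ℝ)
    (hrt : ∀ i, ∀ k ∈ wd, ‖qt i k - ((κ i : ℝ) : ℂ) * et k - Ct k‖ ≤ rt k)
    (hrU : ∀ i, ∀ k ∈ wd, ‖qU i k - ((κ i : ℝ) : ℂ) * eU k - CU k‖ ≤ rU k)
    {tp' U' : ℝ} (hs₁ : s₁ ≤ tp') (hs₂ : tp' ≤ s₂) (hU₁' : U₁ ≤ U') (hU₂ : U' ≤ U₂)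
    {Ls : ℕ → ℕ} (hLs : Tendsto Ls atTop atTop)
    {ψ : ∀ L, Fock (Orb (FermionTorus 2 L))}
    (hψ : ∀ j, IsGroundStateInSector (hubbardTorusTT' (Ls j) t tp' U')
      (ThermodynamicLimit.rectN n (Ls j)) 0 (ψ (Ls j)))
    (hψ1 : ∀ j, star (ψ (Ls j)) ⬝ᵥ ψ (Ls j) = 1)
    {ω : InfVolFermionState 2} (hω : ω.IsTorusLimitOf ψ Ls) :
    F - ((s₂ - s₁) / 2 * ∑ k ∈ wd, rt k + (U₂ - U₁) / 2 * ∑ k ∈ wd, rU k) ≤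
      (ω.expect Λ' Xw).re := by
  obtain ⟨w, hw0, hw1, hws, hwU⟩ := BoxCovering.exists_convexWeights_rectCorners hs₁ hs₂ hU₁' hU₂
  have hU₂0 : U₁ ≤ U₂ := hU₁'.trans hU₂
  have hs₁₂ : s₁ ≤ s₂ := hs₁.trans hs₂
  -- the constant cap is an affine majorant with equal corner values
  have hu : ThermodynamicLimit.energyDensityTT' t tp' U' n ≤ ∑ i ∈ Finset.univ, w i * C := by
    rw [← Finset.sum_mul, hw1, one_mul]; exact hC tp' U' hs₁ hs₂ hU₁' hU₂
  have hkr : ∀ i ∈ (Finset.univ : Finset (Fin 2 × Fin 2)), |κ i - 0| ≤ ∑ j, |κ j| := fun i _ => by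
    rw [sub_zero]
    exact Finset.single_le_sum (f := fun j => |κ j|) (fun j _ => abs_nonneg _) (Finset.mem_univ i)
  have key := hω.re_expect_ge_cellFloor_of_window_certificates_TT'_ineq_at t Finset.univ w
    (fun i _ => hw0 i) hw1 (fun i => (![s₁, s₂] : Fin 2 → ℝ) i.1) (fun i => (![U₁, U₂] : Fin 2 → ℝ) i.2)
    u c κ (fun _ => C) tp' U' hws hwU
    (fun i _ => by
      rcases i with ⟨a, b⟩
      fin_cases b
      · simpa using hU₁
      · simpa using hU₁.trans hU₂0)
    (fun i _ => hκ i) hn0 hn2 hu hΛ h8 h0 hz Xw μ ν Λm (fun i _ => hΛm i) O s B tt γ hγ1 wv hsh Y uu b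
    cw hcw ah dc V wd a word qt qU et eU (fun i _ => hqt i) (fun i _ => hqU i) het heU
    (fun i _ => hcert i) (fun i _ => hF i) (kref := 0) (rκ := ∑ j, |κ j|) hkr (αM := C) (βM := C)
    (fun _ _ => ⟨le_rfl, le_rfl⟩) (αt := s₁) (βt := s₂)
    (fun i _ => by
      rcases i with ⟨a, b⟩
      fin_cases a
      · simpa using hs₁₂
      · simpa using hs₁₂)
    (αU := U₁) (βU := U₂)
    (fun i _ => by
      rcases i with ⟨a, b⟩
      fin_cases b
      · simpa using hU₂0
      · simpa using hU₂0)
    Ct CU rt rU (fun i _ => hrt i) (fun i _ => hrU i) hLs hψ hψ1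
  have e0 : (∑ j, |κ j|) * ((C - C) / 2) = 0 := by ring
  rw [e0, sub_zero] at key
  exact key

end CellFloorOnRect

namespace ThermodynamicLimit

open InfVolFermionState

/-! ### §7 Rectangle window from one anchor column and the box's endpoint `K₂` words -/

/-- **Rectangle FLOOR from a floor row on the low-`U` edge and the edge's endpoint `K₂` words.** Rectangle
`[s₁, s₂] × [U₁, U₂]` (`U₁ ≥ 0`), anchor abscissa `s₀ ∈ [s₁, s₂]`; a certified floor `L ≤ e(t, s₀, U₁, n)`;
a CEILING word `K₂(ω) ≤ A` for every torus-limit ground state at `(s₁, U₁)` and a FLOOR word `B ≤ K₂(ω)`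
at `(s₂, U₁)` (`K₂ = e_{Φ(0,1,0)}`, the diagonal kinetic energy per site at `t' = 1`). Then every point
`(s, U)` of the rectangle (indeed every `U ≥ U₁`) has
`L + min 0 (min (B (s₂ − s₀)) (−(A (s₀ − s₁)))) ≤ e(t, s, U, n)`: along the edge `U = U₁` the increments
are bracketed by the endpoint words (`mul_le_energyDensityTT'_sub_of_forall_le_diagHop`,
`energyDensityTT'_sub_le_mul_of_forall_diagHop_le`), and `e` only grows with `U`
(`energyDensityTT'_mono_U`); `s₀ ∈ [s₁, s₂]` is not even needed. [cite: KomaTasaki1994, §1] -/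
theorem energyDensityTT'_rect_ge_of_anchor_endpointWords (t : ℝ) {n : ℝ} (hn0 : 0 ≤ n) (hn2 : n < 2)
    {s₁ s₀ s₂ U₁ : ℝ} (hU₁ : 0 ≤ U₁) {L A B : ℝ}
    (hL : L ≤ energyDensityTT' t s₀ U₁ n)
    (hA : ∀ (ω₁ : InfVolFermionState 2) (Ls₁ : ℕ → ℕ) (ψ₁ : ∀ L, Fock (Orb (FermionTorus 2 L))),
      Tendsto Ls₁ atTop atTop →
      (∀ j, IsGroundStateInSector (hubbardTorusTT' (Ls₁ j) t s₁ U₁) (rectN n (Ls₁ j)) 0 (ψ₁ (Ls₁ j))) →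
      (∀ j, star (ψ₁ (Ls₁ j)) ⬝ᵥ ψ₁ (Ls₁ j) = 1) → ω₁.IsTorusLimitOf ψ₁ Ls₁ →
      ω₁.meanEnergy (hubbardTTPrimeFermionInteraction 0 1 0) 1 ≤ A)
    (hB : ∀ (ω₂ : InfVolFermionState 2) (Ls₂ : ℕ → ℕ) (ψ₂ : ∀ L, Fock (Orb (FermionTorus 2 L))),
      Tendsto Ls₂ atTop atTop →
      (∀ j, IsGroundStateInSector (hubbardTorusTT' (Ls₂ j) t s₂ U₁) (rectN n (Ls₂ j)) 0 (ψ₂ (Ls₂ j))) →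
      (∀ j, star (ψ₂ (Ls₂ j)) ⬝ᵥ ψ₂ (Ls₂ j) = 1) → ω₂.IsTorusLimitOf ψ₂ Ls₂ →
      B ≤ ω₂.meanEnergy (hubbardTTPrimeFermionInteraction 0 1 0) 1)
    {s U : ℝ} (hs₁ : s₁ ≤ s) (hs₂ : s ≤ s₂) (hU₁' : U₁ ≤ U) :
    L + min 0 (min (B * (s₂ - s₀)) (-(A * (s₀ - s₁)))) ≤ energyDensityTT' t s U n := by
  have hmono := energyDensityTT'_mono_U t s hn0 hn2 hU₁ hU₁'
  -- the edge `U = U₁`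
  have hedge : L + min 0 (min (B * (s₂ - s₀)) (-(A * (s₀ - s₁)))) ≤ energyDensityTT' t s U₁ n := by
    rcases le_total s₀ s with hle | hle
    · have h := mul_le_energyDensityTT'_sub_of_forall_le_diagHop t hle hs₂ hU₁ hn0 hn2 hB
      have hmin : min 0 (min (B * (s₂ - s₀)) (-(A * (s₀ - s₁)))) ≤ B * (s - s₀) := by
        rcases le_total 0 B with hB0 | hB0
        · exact (min_le_left _ _).trans (mul_nonneg hB0 (sub_nonneg.2 hle))
        · exact ((min_le_right _ _).trans (min_le_left _ _)).trans
            (mul_le_mul_of_nonpos_left (by linarith) hB0)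
      linarith
    · have h := energyDensityTT'_sub_le_mul_of_forall_diagHop_le t hs₁ hle hU₁ hn0 hn2 hA
      have hmin : min 0 (min (B * (s₂ - s₀)) (-(A * (s₀ - s₁)))) ≤ -(A * (s₀ - s)) := by
        rcases le_total 0 A with hA0 | hA0
        · refine ((min_le_right _ _).trans (min_le_right _ _)).trans ?_
          exact neg_le_neg (mul_le_mul_of_nonneg_left (by linarith) hA0)
        · exact (min_le_left _ _).trans (by nlinarith [sub_nonneg.2 hle])
      linarith
  exact hedge.trans hmono

/-- **Rectangle CAP from a cap row on the high-`U` edge and the edge's endpoint `K₂` words.** Rectangle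
`[s₁, s₂] × [U₁, U₂]` (`U₁ ≥ 0`), `s₀ ∈ [s₁, s₂]`; a certified cap `e(t, s₀, U₂, n) ≤ R`; a ceiling word
`K₂ ≤ A` at `(s₁, U₂)` and a floor word `B ≤ K₂` at `(s₂, U₂)`. Then every point of the rectangle has
`e(t, s, U, n) ≤ R + max 0 (max (A (s₂ − s₀)) (−(B (s₀ − s₁))))` (increments along `U = U₂` bracketed by
the endpoint words; `e` non-decreasing in `U`). [cite: KomaTasaki1994, §1] -/
theorem energyDensityTT'_rect_le_of_anchor_endpointWords (t : ℝ) {n : ℝ} (hn0 : 0 ≤ n) (hn2 : n < 2)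
    {s₁ s₀ s₂ U₁ U₂ : ℝ} (hU₁ : 0 ≤ U₁) (h₁ : s₁ ≤ s₀) (h₂ : s₀ ≤ s₂) {R A B : ℝ}
    (hR : energyDensityTT' t s₀ U₂ n ≤ R)
    (hA : ∀ (ω₁ : InfVolFermionState 2) (Ls₁ : ℕ → ℕ) (ψ₁ : ∀ L, Fock (Orb (FermionTorus 2 L))),
      Tendsto Ls₁ atTop atTop →
      (∀ j, IsGroundStateInSector (hubbardTorusTT' (Ls₁ j) t s₁ U₂) (rectN n (Ls₁ j)) 0 (ψ₁ (Ls₁ j))) →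
      (∀ j, star (ψ₁ (Ls₁ j)) ⬝ᵥ ψ₁ (Ls₁ j) = 1) → ω₁.IsTorusLimitOf ψ₁ Ls₁ →
      ω₁.meanEnergy (hubbardTTPrimeFermionInteraction 0 1 0) 1 ≤ A)
    (hB : ∀ (ω₂ : InfVolFermionState 2) (Ls₂ : ℕ → ℕ) (ψ₂ : ∀ L, Fock (Orb (FermionTorus 2 L))),
      Tendsto Ls₂ atTop atTop →
      (∀ j, IsGroundStateInSector (hubbardTorusTT' (Ls₂ j) t s₂ U₂) (rectN n (Ls₂ j)) 0 (ψ₂ (Ls₂ j))) →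
      (∀ j, star (ψ₂ (Ls₂ j)) ⬝ᵥ ψ₂ (Ls₂ j) = 1) → ω₂.IsTorusLimitOf ψ₂ Ls₂ →
      B ≤ ω₂.meanEnergy (hubbardTTPrimeFermionInteraction 0 1 0) 1)
    {s U : ℝ} (hs₁ : s₁ ≤ s) (hs₂ : s ≤ s₂) (hU₁' : U₁ ≤ U) (hU₂ : U ≤ U₂) :
    energyDensityTT' t s U n ≤ R + max 0 (max (A * (s₂ - s₀)) (-(B * (s₀ - s₁)))) := by
  have hU0 : 0 ≤ U := hU₁.trans hU₁'
  have hU₂0 : 0 ≤ U₂ := hU0.trans hU₂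
  have hmono := energyDensityTT'_mono_U t s hn0 hn2 hU0 hU₂
  -- the edge `U = U₂`
  have hedge : energyDensityTT' t s U₂ n ≤ R + max 0 (max (A * (s₂ - s₀)) (-(B * (s₀ - s₁)))) := by
    rcases le_total s₀ s with hle | hle
    · have h := energyDensityTT'_sub_le_mul_of_forall_diagHop_le t h₁ hle hU₂0 hn0 hn2 hA
      have hmax : A * (s - s₀) ≤ max 0 (max (A * (s₂ - s₀)) (-(B * (s₀ - s₁)))) := by
        rcases le_total 0 A with hA0 | hA0
        · exact le_trans (mul_le_mul_of_nonneg_left (by linarith) hA0)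
            ((le_max_left _ _).trans (le_max_right _ _))
        · exact le_trans (mul_nonpos_iff.2 (Or.inr ⟨hA0, sub_nonneg.2 hle⟩)) (le_max_left _ _)
      linarith
    · have h := mul_le_energyDensityTT'_sub_of_forall_le_diagHop t hle h₂ hU₂0 hn0 hn2 hB
      have hmax : -(B * (s₀ - s)) ≤ max 0 (max (A * (s₂ - s₀)) (-(B * (s₀ - s₁)))) := by
        rcases le_total 0 B with hB0 | hB0
        · exact le_trans (neg_nonpos.2 (mul_nonneg hB0 (sub_nonneg.2 hle))) (le_max_left _ _)
        · refine le_trans ?_ ((le_max_right _ _).trans (le_max_right _ _))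
          exact neg_le_neg (mul_le_mul_of_nonpos_left (by linarith) hB0)
      linarith
  exact hmono.trans hedge

/-- **Rectangle WINDOW from the two `U`-edges**: floor row at `(s₀, U₁)` + the low-edge endpoint `K₂`
words `A₁, B₁`; cap row at `(s₀', U₂)`, `s₀' ∈ [s₁, s₂]`, + the high-edge endpoint words `A₂, B₂` (the
anchors' abscissae `s₀, s₀'` may differ). [cite: KomaTasaki1994, §1] -/
theorem energyDensityTT'_rect_mem_Icc_of_anchor_endpointWords (t : ℝ) {n : ℝ} (hn0 : 0 ≤ n)
    (hn2 : n < 2) {s₁ s₀ s₀' s₂ U₁ U₂ : ℝ} (hU₁ : 0 ≤ U₁)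
    (h₁' : s₁ ≤ s₀') (h₂' : s₀' ≤ s₂) {L R A₁ B₁ A₂ B₂ : ℝ}
    (hL : L ≤ energyDensityTT' t s₀ U₁ n) (hR : energyDensityTT' t s₀' U₂ n ≤ R)
    (hA₁ : ∀ (ω₁ : InfVolFermionState 2) (Ls₁ : ℕ → ℕ) (ψ₁ : ∀ L, Fock (Orb (FermionTorus 2 L))),
      Tendsto Ls₁ atTop atTop →
      (∀ j, IsGroundStateInSector (hubbardTorusTT' (Ls₁ j) t s₁ U₁) (rectN n (Ls₁ j)) 0 (ψ₁ (Ls₁ j))) →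
      (∀ j, star (ψ₁ (Ls₁ j)) ⬝ᵥ ψ₁ (Ls₁ j) = 1) → ω₁.IsTorusLimitOf ψ₁ Ls₁ →
      ω₁.meanEnergy (hubbardTTPrimeFermionInteraction 0 1 0) 1 ≤ A₁)
    (hB₁ : ∀ (ω₂ : InfVolFermionState 2) (Ls₂ : ℕ → ℕ) (ψ₂ : ∀ L, Fock (Orb (FermionTorus 2 L))),
      Tendsto Ls₂ atTop atTop →
      (∀ j, IsGroundStateInSector (hubbardTorusTT' (Ls₂ j) t s₂ U₁) (rectN n (Ls₂ j)) 0 (ψ₂ (Ls₂ j))) →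
      (∀ j, star (ψ₂ (Ls₂ j)) ⬝ᵥ ψ₂ (Ls₂ j) = 1) → ω₂.IsTorusLimitOf ψ₂ Ls₂ →
      B₁ ≤ ω₂.meanEnergy (hubbardTTPrimeFermionInteraction 0 1 0) 1)
    (hA₂ : ∀ (ω₁ : InfVolFermionState 2) (Ls₁ : ℕ → ℕ) (ψ₁ : ∀ L, Fock (Orb (FermionTorus 2 L))),
      Tendsto Ls₁ atTop atTop →
      (∀ j, IsGroundStateInSector (hubbardTorusTT' (Ls₁ j) t s₁ U₂) (rectN n (Ls₁ j)) 0 (ψ₁ (Ls₁ j))) →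
      (∀ j, star (ψ₁ (Ls₁ j)) ⬝ᵥ ψ₁ (Ls₁ j) = 1) → ω₁.IsTorusLimitOf ψ₁ Ls₁ →
      ω₁.meanEnergy (hubbardTTPrimeFermionInteraction 0 1 0) 1 ≤ A₂)
    (hB₂ : ∀ (ω₂ : InfVolFermionState 2) (Ls₂ : ℕ → ℕ) (ψ₂ : ∀ L, Fock (Orb (FermionTorus 2 L))),
      Tendsto Ls₂ atTop atTop →
      (∀ j, IsGroundStateInSector (hubbardTorusTT' (Ls₂ j) t s₂ U₂) (rectN n (Ls₂ j)) 0 (ψ₂ (Ls₂ j))) →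
      (∀ j, star (ψ₂ (Ls₂ j)) ⬝ᵥ ψ₂ (Ls₂ j) = 1) → ω₂.IsTorusLimitOf ψ₂ Ls₂ →
      B₂ ≤ ω₂.meanEnergy (hubbardTTPrimeFermionInteraction 0 1 0) 1)
    {s U : ℝ} (hs₁ : s₁ ≤ s) (hs₂ : s ≤ s₂) (hU₁' : U₁ ≤ U) (hU₂ : U ≤ U₂) :
    energyDensityTT' t s U n ∈
      Set.Icc (L + min 0 (min (B₁ * (s₂ - s₀)) (-(A₁ * (s₀ - s₁)))))
        (R + max 0 (max (A₂ * (s₂ - s₀')) (-(B₂ * (s₀' - s₁))))) :=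
  ⟨energyDensityTT'_rect_ge_of_anchor_endpointWords t hn0 hn2 hU₁ hL hA₁ hB₁ hs₁ hs₂ hU₁',
    energyDensityTT'_rect_le_of_anchor_endpointWords t hn0 hn2 hU₁ h₁' h₂' hR hA₂ hB₂ hs₁ hs₂ hU₁' hU₂⟩

end ThermodynamicLimit

end Literature.MathematicalPhysics.QuantumLattice

end
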